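import Summits.ValiantsHypothesis.ValiantsHypothesis.Theorems.KPlusLogSqLawWeakLiftingTowerGraftTwoSidedClusteredUppers
import Summits.ValiantsHypothesis.ValiantsHypothesis.Theorems.KPlusLogSqLawWeakLiftingTowerGraftTwoSidedThreeLettersLaw
import Literature.Computability.AlgebraicComplexity.MignonRessayreBound
import Literature.Computability.AlgebraicComplexity.HessianRank

/-!
# Tower graft line — BEYOND CLUSTERING: the split-certificate law and the EXCHANGE certificate on commensurable supports

Crux `stmt-ValiantsHypothesis-19561` (`WeakLifting`), line (B) `tower_graft`, two-sided word instrument; seat val-sym-lift-p3 g21,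
`--supports 19561`, NO stub claimed.  The rank-certificate laws of parts A–K and of `…TwoSidedClusteredAll` need a POSITIVE SEMIDEFINITE
Loewner certificate, which exists exactly on CLUSTERED supports (operator-monotone exponents `≤ 1`); on towers the `2m` law fails
(`TowerEscape.not_two_mul_law_tower`).  This file keeps part F's Gram identity `Gram_{P₀} = Σₗ Gram_{Pₗ} ⊙ Nₗ + diag(>0)` but lets each
certificate be positive semidefinite only UP TO `rₗ` RANK-ONE MATRICES (`Nₗ + Σⱼ wwᵀ ⪰ 0`): then the entering-type kernel pairs number at
most `rank P₀ + Σₗ rₗ·rank Pₗ` (`card_negType_le_rank_split`; `Gram ⊙ wwᵀ = D_w Gram D_w` has rank `≤ rank Pₗ`, ranks are subadditive —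
`Literature.Computability.AlgebraicComplexity.rank_add_le` / `rank_sum_le`, imported, not restated).  On COMMENSURABLE supports — the pivot gap `e` divides every gap,
`dₗ = e(qₗ + 1)`; every support `(0, 1, d₂, …, d_K)` and in particular every TOWER of the cell's column qualifies — the natural certificate
`Nₗ = [sᵢsₖ h_{qₗ−1}(sᵢ,sₖ)]` (`s = τ^e`, `geom_sum₂_mul`) is the Gram matrix of the EXCHANGE form on the `qₗ` vectors `y_c = s^{c+1}`, and
`Nₗ + Σ_c y_c y_cᵀ = Σ_c ½(y_c + y_{q−1−c})(y_c + y_{q−1−c})ᵀ ⪰ 0` (`exchange_split`), so `rₗ = qₗ`: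
`card_negType_le_rank_commensurable` — entering-type pairs `≤ rank P₀ + Σₗ qₗ·rank Pₗ`, a LINEAR-IN-`m` law with NO clustering hypothesis
(constant growing with the exponent ratios `qₗ = dₗ/e − 1`; the sharp inertia of these Loewner/exchange matrices — `⌊q/2⌋` negative
eigenvalues, Bhatia–Friedland–Jain for real exponents — would halve it).  Census sequel: `…TwoSidedCommensurable`.  HONEST FRAMING: a
structural law for one-pivot words (one arbitrary letter next to a definite bottom, PSD letters above); NOT a tower graft law (the cost
depends on the far exponent); nothing on S4…S5, `TowerB`, `WeakLifting` in its window, Conjecture B, 18050 or `VP ≠ VNP`.  Def-free.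

[folklore] Gram/Hadamard rank arguments; geometric-sum (exchange) kernels.
-/

set_option linter.dupNamespace false
set_option autoImplicit false

namespace Summit.ValiantsHypothesis.ValiantsHypothesis.Theorems.KPlusLogSqLaw.TowerGraft

open Matrix
open scoped BigOperators

namespace TwoSidedThree

/-! ## §1 Linear algebra: Hadamard products with rank-one matrices, ranks of sums -/

section LinAlg

variable {I : Type} [Fintype I] [DecidableEq I]

/-- `G ⊙ (w wᵀ) = diag(w) · G · diag(w)`. [folklore] -/
theorem hadamard_vecMulVec_eq_diagonal_mul (G : Matrix I I ℝ) (w : I → ℝ) :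
    G ⊙ Matrix.vecMulVec w w = Matrix.diagonal w * G * Matrix.diagonal w := by
  ext i k
  simp only [Matrix.hadamard_apply, Matrix.vecMulVec_apply, Matrix.mul_diagonal, Matrix.diagonal_mul]
  ring

/-- the Hadamard product with a rank-one matrix does not increase the rank. [folklore] -/
theorem rank_hadamard_vecMulVec_le (G : Matrix I I ℝ) (w : I → ℝ) :
    (G ⊙ Matrix.vecMulVec w w).rank ≤ G.rank := by
  rw [hadamard_vecMulVec_eq_diagonal_mul]
  exact (Matrix.rank_mul_le_left _ _).trans (Matrix.rank_mul_le_right _ _)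

omit [Fintype I] [DecidableEq I] in
/-- the Hadamard product distributes over finite sums (right factor). [folklore] -/
theorem hadamard_finset_sum {κ : Type} (s : Finset κ) (G : Matrix I I ℝ) (B : κ → Matrix I I ℝ) :
    G ⊙ (∑ j ∈ s, B j) = ∑ j ∈ s, G ⊙ B j := by
  ext i k
  simp only [Matrix.hadamard_apply, Matrix.sum_apply, Finset.mul_sum]

end LinAlg

/-! ## §2 The SPLIT-CERTIFICATE theorem: one-pivot words with upper letters at ANY gaps -/

section Split

variable {m : ℕ} {I : Type} [Fintype I] [DecidableEq I] {L : ℕ}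
variable (P₀ J : Matrix (Fin m) (Fin m) ℝ) (P : Fin L → Matrix (Fin m) (Fin m) ℝ) (e : ℕ) (d : Fin L → ℕ)
  (τ : I → ℝ) (u : I → Fin m → ℝ)

/-- **THE SPLIT-CERTIFICATE LAW (one-pivot words, upper letters at arbitrary gaps).**  Word `P₀ + τ^e J + Σₗ τ^{dₗ} Pₗ`
(`P₀, Pₗ ⪰ 0`, `J` ANY symmetric, `e ≥ 1`, `dₗ > e`), kernel pairs `(τᵢ, uᵢ)` at distinct positive scales of NEGATIVE (entering) type.
Suppose each letter carries a certificate `Nₗ` with the entries of part F (`e·(Nₗ)ᵢᵢ = (dₗ − e)τᵢ^{dₗ}`,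
`(Nₗ)ᵢₖ(τᵢ^e − τₖ^e) = τᵢ^{dₗ}τₖ^e − τᵢ^eτₖ^{dₗ}`) which is positive semidefinite UP TO `rₗ` RANK-ONE MATRICES:
`Nₗ + Σ_{j<rₗ} wₗⱼwₗⱼᵀ = Aₗ ⪰ 0`.  Then `#I ≤ rank P₀ + Σₗ rₗ·rank Pₗ`: from `Gram_{P₀} = Σₗ Gram_{Pₗ} ⊙ Nₗ + diag(>0)` (part F's identity)
`Gram_{P₀} + Σₗ Σⱼ Gram_{Pₗ} ⊙ wwᵀ ≻ 0` has rank `#I`, while `rank(Gram_{Pₗ} ⊙ wwᵀ) = rank(D_w Gram_{Pₗ} D_w) ≤ rank Pₗ`.  Part F is the case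
`rₗ = 0` (clustered supports, Loewner certificates PSD); on NON-clustered supports the Loewner kernels have negative eigenvalues and `rₗ`
counts them. [folklore] -/
theorem card_negType_le_rank_split (hP₀ : P₀.PosSemidef) (hJ : J.IsSymm) (hP : ∀ l, (P l).PosSemidef)
    (hτ : ∀ i, 0 < τ i) (hinj : Function.Injective τ) (he : 0 < e)
    (hker : ∀ i, (P₀ + τ i ^ e • J + ∑ l, τ i ^ d l • P l) *ᵥ u i = 0)
    (htype : ∀ i, ∑ l, ((d l - e : ℕ) : ℝ) * τ i ^ d l * (u i ⬝ᵥ (P l *ᵥ u i)) < e * (u i ⬝ᵥ (P₀ *ᵥ u i)))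
    (N : Fin L → Matrix I I ℝ)
    (hNdiag : ∀ l i, (e : ℝ) * N l i i = ((d l - e : ℕ) : ℝ) * τ i ^ d l)
    (hNoff : ∀ l i k, i ≠ k → N l i k * (τ i ^ e - τ k ^ e) = τ i ^ d l * τ k ^ e - τ i ^ e * τ k ^ d l)
    (r : Fin L → ℕ) (w : (l : Fin L) → Fin (r l) → I → ℝ) (A : Fin L → Matrix I I ℝ) (hA : ∀ l, (A l).PosSemidef)
    (hsplit : ∀ l, N l + ∑ j, Matrix.vecMulVec (w l j) (w l j) = A l) :
    Fintype.card I ≤ P₀.rank + ∑ l, r l * (P l).rank := by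
  classical
  have hP₀s : P₀.IsSymm := by
    have h1 := hP₀.1; unfold Matrix.IsHermitian at h1
    rwa [Matrix.conjTranspose_eq_transpose_of_trivial] at h1
  have hPs : ∀ l, (P l).IsSymm := by
    intro l; have h1 := (hP l).1; unfold Matrix.IsHermitian at h1
    rwa [Matrix.conjTranspose_eq_transpose_of_trivial] at h1
  have hene : (e : ℝ) ≠ 0 := Nat.cast_ne_zero.mpr (Nat.pos_iff_ne_zero.mp he)
  have hepos : (0 : ℝ) < e := Nat.cast_pos.mpr he
  -- Gram matrices
  set G₀ : Matrix I I ℝ := Matrix.of fun i' k' => u i' ⬝ᵥ (P₀ *ᵥ u k') with hG₀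
  set G : Fin L → Matrix I I ℝ := fun l => Matrix.of fun i' k' => u i' ⬝ᵥ (P l *ᵥ u k') with hG
  have hGpsd : ∀ l, (G l).PosSemidef := fun l => posSemidef_gram (hP l) u
  -- the diagonal
  set Δ : I → ℝ := fun i => u i ⬝ᵥ (P₀ *ᵥ u i) - ∑ l, (u i ⬝ᵥ (P l *ᵥ u i)) * N l i i with hΔdef
  have hΔpos : ∀ i, 0 < Δ i := by
    intro i
    have ht := htype i
    have h1 : (e : ℝ) * ∑ l, (u i ⬝ᵥ (P l *ᵥ u i)) * N l i i
        = ∑ l, ((d l - e : ℕ) : ℝ) * τ i ^ d l * (u i ⬝ᵥ (P l *ᵥ u i)) := by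
      rw [Finset.mul_sum]
      refine Finset.sum_congr rfl fun l _ => ?_
      rw [show (e : ℝ) * ((u i ⬝ᵥ (P l *ᵥ u i)) * N l i i) = ((e : ℝ) * N l i i) * (u i ⬝ᵥ (P l *ᵥ u i)) by ring,
        hNdiag l i]
    have h2 : (e : ℝ) * Δ i = e * (u i ⬝ᵥ (P₀ *ᵥ u i)) - ∑ l, ((d l - e : ℕ) : ℝ) * τ i ^ d l * (u i ⬝ᵥ (P l *ᵥ u i)) := by
      simp only [hΔdef]; rw [mul_sub, h1]
    have h3 : 0 < (e : ℝ) * Δ i := by rw [h2]; linarith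
    exact pos_of_mul_pos_right h3 hepos.le
  -- part F's identity `Gram_{P₀} = Σₗ Gram_{Pₗ} ⊙ Nₗ + diag Δ`
  have hdecomp : G₀ = (∑ l, G l ⊙ N l) + Matrix.diagonal Δ := by
    ext i k
    rw [Matrix.add_apply, hG₀, Matrix.of_apply, Matrix.sum_apply]
    simp only [Matrix.hadamard_apply, hG, Matrix.of_apply]
    by_cases hik : i = k
    · subst hik
      rw [Matrix.diagonal_apply_eq]
      simp only [hΔdef]; ring
    · rw [Matrix.diagonal_apply_ne _ hik, add_zero]
      have hne : τ i ^ e - τ k ^ e ≠ 0 := by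
        intro h0
        apply hik; apply hinj
        exact (pow_left_inj₀ (hτ i).le (hτ k).le (Nat.pos_iff_ne_zero.mp he)).mp (sub_eq_zero.mp h0)
      have hg := gramP0_eq_clustered P₀ J P e d τ u hP₀s hJ hPs hker i k
      apply mul_left_cancel₀ hne
      rw [hg, Finset.mul_sum]
      refine Finset.sum_congr rfl fun l _ => ?_
      rw [← hNoff l i k hik]
      ring
  -- the positive definite matrix `M = Σₗ Gₗ ⊙ Aₗ + diag Δ`
  set M : Matrix I I ℝ := (∑ l, G l ⊙ A l) + Matrix.diagonal Δ with hM
  have hS : (∑ l, G l ⊙ A l).PosSemidef := posSemidef_sum _ fun l => (hGpsd l).hadamard (hA l)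
  have hMpd : M.PosDef := by
    rw [Matrix.posDef_iff_dotProduct_mulVec]
    refine ⟨?_, fun x hx => ?_⟩
    · have h1 := hS.1
      have h2 : (Matrix.diagonal Δ).IsHermitian := by
        rw [Matrix.IsHermitian, Matrix.conjTranspose_eq_transpose_of_trivial, Matrix.diagonal_transpose]
      exact h1.add h2
    · rw [hM, Matrix.add_mulVec, dotProduct_add]
      have h1 : 0 ≤ star x ⬝ᵥ ((∑ l, G l ⊙ A l) *ᵥ x) := (Matrix.posSemidef_iff_dotProduct_mulVec.mp hS).2 x
      have h2 : 0 < star x ⬝ᵥ (Matrix.diagonal Δ *ᵥ x) := by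
        rw [star_trivial]
        simp only [dotProduct, Matrix.mulVec_diagonal]
        obtain ⟨i₀, hi₀⟩ := Function.ne_iff.mp hx
        apply Finset.sum_pos'
        · intro i _
          have := hΔpos i
          nlinarith [sq_nonneg (x i)]
        · refine ⟨i₀, Finset.mem_univ _, ?_⟩
          have := hΔpos i₀
          have hx0 : 0 < x i₀ ^ 2 := sq_pos_iff.mpr hi₀
          nlinarith
      linarith
  have hrankM : M.rank = Fintype.card I := Matrix.rank_of_isUnit _ hMpd.isUnit
  -- `M = G₀ + Σₗ Σⱼ Gₗ ⊙ wwᵀ`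
  have hMeq : M = G₀ + ∑ l, ∑ j, G l ⊙ Matrix.vecMulVec (w l j) (w l j) := by
    rw [hM, hdecomp, add_assoc, add_comm (Matrix.diagonal Δ), ← add_assoc, ← Finset.sum_add_distrib]
    congr 1
    refine Finset.sum_congr rfl fun l _ => ?_
    rw [← hadamard_finset_sum, ← Matrix.hadamard_add, hsplit l]
  -- rank count
  have hGr : ∀ l, (G l).rank ≤ (P l).rank := fun l => rank_gram_le (P l) u
  have h1 : M.rank ≤ G₀.rank + (∑ l, ∑ j, G l ⊙ Matrix.vecMulVec (w l j) (w l j)).rank := by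
    rw [hMeq]; exact Literature.Computability.AlgebraicComplexity.rank_add_le _ _
  have h2 : (∑ l, ∑ j, G l ⊙ Matrix.vecMulVec (w l j) (w l j)).rank ≤ ∑ l, r l * (P l).rank := by
    refine (Literature.Computability.AlgebraicComplexity.rank_sum_le _ _).trans (Finset.sum_le_sum fun l _ => ?_)
    refine (Literature.Computability.AlgebraicComplexity.rank_sum_le _ _).trans ?_
    calc ∑ j, (G l ⊙ Matrix.vecMulVec (w l j) (w l j)).rank ≤ ∑ _j : Fin (r l), (P l).rank :=
          Finset.sum_le_sum fun j _ => (rank_hadamard_vecMulVec_le _ _).trans (hGr l)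
      _ = r l * (P l).rank := by simp
  have h0 : G₀.rank ≤ P₀.rank := rank_gram_le P₀ u
  calc Fintype.card I = M.rank := hrankM.symm
    _ ≤ P₀.rank + ∑ l, r l * (P l).rank := h1.trans (Nat.add_le_add h0 h2)

end Split

end TwoSidedThree

end Summit.ValiantsHypothesis.ValiantsHypothesis.Theorems.KPlusLogSqLaw.TowerGraft

namespace Summit.ValiantsHypothesis.ValiantsHypothesis.Theorems.KPlusLogSqLaw.TowerGraft

open Matrix
open scoped BigOperators

namespace TwoSidedThree

/-! ## §3 The EXCHANGE certificate on commensurable supports: `dₗ = e(qₗ + 1)` -/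

section Exchange

variable {m : ℕ} {I : Type} [Fintype I] [DecidableEq I] {L : ℕ}

omit [DecidableEq I] in
/-- reflection `c ↦ q−1−c` of a `Fin q`-sum. [folklore] -/
theorem sum_fin_rev_eq {q : ℕ} (f : Fin q → ℝ) : ∑ c : Fin q, f (Fin.rev c) = ∑ c : Fin q, f c :=
  Equiv.sum_comp Fin.revPerm f

omit [Fintype I] [DecidableEq I] in
/-- **the exchange certificate splits**: for `y : Fin q → (I → ℝ)` the matrix `[Σ_c y_c(i) y_{q−1−c}(k)]` (a Gram matrix for the
EXCHANGE form) plus `Σ_c y_c y_cᵀ` equals `Σ_c ½ (y_c + y_{q−1−c})(y_c + y_{q−1−c})ᵀ`, which is positive semidefinite. [folklore] -/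
theorem exchange_split (q : ℕ) (y : Fin q → I → ℝ) :
    (Matrix.of fun i k => ∑ c : Fin q, y c i * y (Fin.rev c) k) + ∑ c : Fin q, Matrix.vecMulVec (y c) (y c)
      = ∑ c : Fin q, ((1 / 2 : ℝ) • Matrix.vecMulVec (y c + y (Fin.rev c)) (y c + y (Fin.rev c))) := by
  ext i k
  rw [Matrix.add_apply, Matrix.of_apply, Matrix.sum_apply, Matrix.sum_apply]
  simp only [Matrix.vecMulVec_apply, Matrix.smul_apply, Pi.add_apply, smul_eq_mul]
  have h1 : ∑ c : Fin q, y (Fin.rev c) i * y (Fin.rev c) k = ∑ c : Fin q, y c i * y c k :=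
    sum_fin_rev_eq (fun c => y c i * y c k)
  have h2 : ∑ c : Fin q, y (Fin.rev c) i * y c k = ∑ c : Fin q, y c i * y (Fin.rev c) k := by
    rw [← sum_fin_rev_eq (fun c => y c i * y (Fin.rev c) k)]
    simp only [Fin.rev_rev]
  have h3 : ∑ c : Fin q, (1 / 2 : ℝ) * ((y c i + y (Fin.rev c) i) * (y c k + y (Fin.rev c) k))
      = (1 / 2 : ℝ) * (∑ c : Fin q, y c i * y (Fin.rev c) k + ∑ c : Fin q, y c i * y c k
          + ∑ c : Fin q, y (Fin.rev c) i * y c k + ∑ c : Fin q, y (Fin.rev c) i * y (Fin.rev c) k) := by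
    rw [← Finset.mul_sum, ← Finset.sum_add_distrib, ← Finset.sum_add_distrib, ← Finset.sum_add_distrib]
    congr 1
    exact Finset.sum_congr rfl fun c _ => by ring
  rw [h3, h1, h2]
  ring

omit [DecidableEq I] in
/-- the split right-hand side is positive semidefinite. [folklore] -/
theorem posSemidef_exchange_split (q : ℕ) (y : Fin q → I → ℝ) :
    (∑ c : Fin q, ((1 / 2 : ℝ) • Matrix.vecMulVec (y c + y (Fin.rev c)) (y c + y (Fin.rev c)))).PosSemidef := by
  refine posSemidef_sum _ fun c => ?_
  have h := Matrix.posSemidef_vecMulVec_self_star (R := ℝ) (y c + y (Fin.rev c))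
  rw [star_trivial] at h
  exact h.smul (by norm_num)

variable (P₀ J : Matrix (Fin m) (Fin m) ℝ) (P : Fin L → Matrix (Fin m) (Fin m) ℝ) (e : ℕ) (d q : Fin L → ℕ)
  (τ : I → ℝ) (u : I → Fin m → ℝ)

/-- **THE COMMENSURABLE-SUPPORT LAW (kernel, every one-pivot word whose pivot gap divides all gaps).**  Word
`P₀ + τ^e J + Σₗ τ^{dₗ} Pₗ` with `dₗ = e(qₗ + 1)`, `qₗ ≥ 1` (supports `(d₀, d₀+g, d₀+g(q₁+1), …)` — the pivot gap `g` DIVIDES every gap;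
e.g. every support `(0, 1, d₂, …, d_K)`, in particular all TOWERS `(0,1,6,36)`, `(0,1,5,25)`), `P₀, Pₗ ⪰ 0`, `J` ANY symmetric: the
entering-type kernel pairs at distinct positive scales number at most `rank P₀ + Σₗ qₗ·rank Pₗ`.  Certificate: `Nₗ = sᵢsₖ·h_{qₗ−1}(sᵢ,sₖ)`
(`s = τ^e`; `geom_sum₂_mul`) is a Gram matrix of the EXCHANGE form on `q` vectors `y_c = s^{c+1}`, and `Nₗ + Σ_c y_c y_cᵀ ⪰ 0`
(`exchange_split`), so `card_negType_le_rank_split` applies with `rₗ = qₗ`.  No clustering hypothesis: a LINEAR-IN-`m` law on every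
commensurable support, the constant growing with the exponent ratios `qₗ = dₗ/e − 1`. [folklore] -/
theorem card_negType_le_rank_commensurable (hP₀ : P₀.PosSemidef) (hJ : J.IsSymm) (hP : ∀ l, (P l).PosSemidef)
    (hτ : ∀ i, 0 < τ i) (hinj : Function.Injective τ) (he : 0 < e) (hq : ∀ l, 1 ≤ q l) (hd : ∀ l, d l = e * (q l + 1))
    (hker : ∀ i, (P₀ + τ i ^ e • J + ∑ l, τ i ^ d l • P l) *ᵥ u i = 0)
    (htype : ∀ i, ∑ l, ((d l - e : ℕ) : ℝ) * τ i ^ d l * (u i ⬝ᵥ (P l *ᵥ u i)) < e * (u i ⬝ᵥ (P₀ *ᵥ u i))) :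
    Fintype.card I ≤ P₀.rank + ∑ l, q l * (P l).rank := by
  classical
  -- `s = τ^e`, `y_{l,c}(i) = sᵢ^{c+1}`
  set s : I → ℝ := fun i => τ i ^ e with hs
  have hspos : ∀ i, 0 < s i := fun i => pow_pos (hτ i) e
  set y : (l : Fin L) → Fin (q l) → I → ℝ := fun l c i => s i ^ ((c : ℕ) + 1) with hy
  set N : Fin L → Matrix I I ℝ := fun l => Matrix.of fun i k => ∑ c : Fin (q l), y l c i * y l (Fin.rev c) k with hN
  -- the entries of `N l`: `sᵢ sₖ h_{q−1}(sᵢ, sₖ)`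
  have hNent : ∀ l i k, N l i k = s i * s k * ∑ c ∈ Finset.range (q l), s i ^ c * s k ^ (q l - 1 - c) := by
    intro l i k
    simp only [hN, Matrix.of_apply, hy, Fin.val_rev]
    rw [Fin.sum_univ_eq_sum_range (fun c => s i ^ (c + 1) * s k ^ (q l - (c + 1) + 1)) (q l), Finset.mul_sum]
    refine Finset.sum_congr rfl fun c hc => ?_
    have hc' : c < q l := Finset.mem_range.mp hc
    have e1 : q l - (c + 1) + 1 = q l - 1 - c + 1 := by omega
    rw [e1, pow_succ, pow_succ]
    ring
  have htd : ∀ l i, τ i ^ d l = s i ^ (q l + 1) := by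
    intro l i; rw [hd l, pow_mul]
  refine card_negType_le_rank_split P₀ J P e d τ u hP₀ hJ hP hτ hinj he hker htype N ?_ ?_ q y
    (fun l => ∑ c : Fin (q l), ((1 / 2 : ℝ) • Matrix.vecMulVec (y l c + y l (Fin.rev c)) (y l c + y l (Fin.rev c))))
    (fun l => posSemidef_exchange_split (q l) (y l)) (fun l => exchange_split (q l) (y l))
  · -- diagonal: `e·N_{ii} = (d − e)·τ^d`
    intro l i
    rw [hNent, geom_sum₂_self, htd]
    have hq1 : 1 ≤ q l := hq l
    have hcast : ((d l - e : ℕ) : ℝ) = (e : ℝ) * (q l : ℝ) := by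
      rw [hd l, show e * (q l + 1) - e = e * q l by rw [Nat.mul_succ, Nat.add_sub_cancel]]
      push_cast; ring
    rw [hcast]
    have epow : s i * s i * ((q l : ℝ) * s i ^ (q l - 1)) = (q l : ℝ) * s i ^ (q l + 1) := by
      obtain ⟨r, hr⟩ := Nat.exists_eq_add_of_le hq1
      rw [hr, Nat.add_sub_cancel_left, pow_add, pow_add, pow_one]; ring
    rw [epow]; ring
  · -- off-diagonal: `N_{ik}(τᵢ^e − τₖ^e) = τᵢ^d τₖ^e − τᵢ^e τₖ^d`
    intro l i k _
    rw [hNent, htd, htd]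
    show s i * s k * (∑ c ∈ Finset.range (q l), s i ^ c * s k ^ (q l - 1 - c)) * (s i - s k)
      = s i ^ (q l + 1) * s k - s i * s k ^ (q l + 1)
    rw [mul_assoc, geom_sum₂_mul, pow_succ, pow_succ]
    ring

end Exchange

end TwoSidedThree

end Summit.ValiantsHypothesis.ValiantsHypothesis.Theorems.KPlusLogSqLaw.TowerGraft
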